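import Summits.BirchSwinnertonDyer.BirchSwinnertonDyer.Theorems.EisensteinPrimesBSDpOnCellCReorientedComposition
import HarnessLib

/-!
# Crux 4 `BSDpOnCellC` (stmt-BirchSwinnertonDyer-19034), line b1 v9: the crux AT THE PRE TIER in ONE theorem —
# `BSDpOnCellC` from the 16 published facts + [cas-split] + the value atom at `p = 3` + KELLER–YIN THM. D BY
# NAME + crux 3 (cell `bsd-eis`, seat `bsd-eis-cgshw` g12)

HONEST FRAMING (cell `bsd-eis`, run/shared/lean/pub/bsd-eis/): one conditional theorem; nothing booked; X2 stays
CONSTRUCTION-SHAPED; no label or count moves; BSD is not proved by any of this. The theorem is CONDITIONAL on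
(i) sixteen published named facts and [cas-split] (fact-grade), (ii) the value atom c2 at `3 ‖ N` (NOT in
print; two memo-level derivations on file, RULING L11 (G6)), (iii) **`KellerYin2024.thmD_imcMult_exists_isBDPLFunction_isTorsion_charIdeal_eq_OPEN`**
— Keller–Yin arXiv:2402.12781v2 Thm. D = Thm. 5.1.3, an UNREFEREED PREPRINT whose printed proof is gapped at
L1754 (flag `KYD-gap`), taken BY NAME —, and (iv) crux 3 `MazurMCOnCellB` (OPEN). It is RULING L32's census
sentence («after v9 the OPEN mathematical content of crux 4 on cell C = c2@3 + crux 3 + KY24 Thm D as a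
named PRE fact») as a kernel statement: skeleton v9's re-oriented `stub_c3` is discharged BY NAME by
`X2.forall_{nonsplit,split}IMCEqOnTreeIntOther_of_thmD_OPEN` (p487050, on c3h g3's p481783), and the other
three stubs are the displayed hypotheses. Nothing here asserts Thm. D.

References: [KellerYin2024] Thm. D = Thm. 5.1.3 (arXiv:2402.12781v2 L306–L309, L1725–L1780; PRE);
[Castella2018Exceptional] Thms. 2.10–2.11; [Hsieh2014] Thm. 1; [CastellaEtAl2021] Thm. 5.3.1; [Miller2011LMS]
Def. 1.1; RULINGS L31 / L32 / L33.
-/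

set_option autoImplicit false
set_option linter.dupNamespace false

noncomputable section

open scoped Classical MatrixGroups ModularForm

open CongruenceSubgroup WeierstrassCurve NumberField IsDedekindDomain Field PowerSeries
  Literature.NumberTheory.EllipticCurves Literature.NumberTheory.EllipticCurves.GreenbergSelmer
  Literature.NumberTheory.EllipticCurves.ModularForms Literature.NumberTheory.QuadraticFields
  Literature.NumberTheory.EllipticCurves.Rank1Residual
  Literature.NumberTheory.EllipticCurves.Rank1Residual.Typed
  Literature.NumberTheory.EllipticCurves.GreenbergVatsal2000
  Literature.NumberTheory.EllipticCurves.Wuthrich2014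
  Literature.NumberTheory.EllipticCurves.SteinWuthrich2013
  Literature.NumberTheory.EllipticCurves.Castella2018Exceptional
  Literature.NumberTheory.GaloisRepresentations Literature.NumberTheory.GaloisCohomology
  Literature.NumberTheory.Automorphic
  Summit.BirchSwinnertonDyer.Rank1Residual.X11b.AcSelmer
  Summit.BirchSwinnertonDyer.Rank1Residual.X11b.Halves
  Summit.BirchSwinnertonDyer.Rank1Residual.X11b
  Summit.BirchSwinnertonDyer.Rank1Residual.X2
  Summit.BirchSwinnertonDyer.Rank1Residual

namespace Summit.BirchSwinnertonDyer.BirchSwinnertonDyer.Theorems.Reoriented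

/-- **Crux 4 `BSDpOnCellC` AT THE PRE TIER: from the 16 published facts + [cas-split] (`hPub`, = v9's
`stub_publishedFacts` verbatim), the value atom at `p = 3` both signs (`h2`, = v9's `stub_c2` verbatim),
Keller–Yin Thm. D BY NAME (`hD`, PREPRINT, gapped — the binder of
`Literature/…/KellerYin2024/MultiplicativeReduction.lean`), and crux 3 (`hMCB`, = the route decl
`MazurMCOnCellB`).** Proof: `bsdpOnCellC_of_stubs_reoriented` with its `stub_c3′` slot filled by
`⟨X2.forall_nonsplitIMCEqOnTreeIntOther_of_thmD_OPEN hD, X2.forall_splitIMCEqOnTreeIntOther_of_thmD_OPEN hD⟩`.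
So, CONDITIONALLY on Thm. D as printed (and on c2@3 and crux 3), `BSD(E,p)` holds in Miller's form at every
X2c pair (`E[p]` reducible, `p ‖ N` odd, analytic rank 1; 12 665 cells, 12 106 at `p = 3`). This is a
`conditional-result`: it credits nothing and books nothing; it records where the crux stands.
[claim: KellerYin2024, status: under-review] [cite: KellerYin2024, Thm. D = Thm. 5.1.3 (arXiv:2402.12781v2 L306–L309)]
[cite: Castella2018Exceptional, Thm. 2.10 and Thm. 2.11 (arXiv:1507.04260 pp. 13–14)]
[cite: Hsieh2014, Thm. 1 (arXiv:1112.1580 pp. 3–4)] [cite: CastellaEtAl2021, Thm. 5.3.1] [cite: Miller2011LMS, Def. 1.1] -/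
theorem bsdpOnCellC_of_thmD_OPEN
    (hPub : (lambdaMu_multiplicative_of_gvPar ∧ thm16_charIdeal_dvd_multiplicative_of_reducible ∧
      thm61_splitMultiplicative ∧ thm61_nonsplitMultiplicative ∧
      (∀ (W : WeierstrassCurve ℚ) [W.IsElliptic] [W.IsGloballyMinimal] (p : ℕ) [Fact p.Prime],
        greenberg_stevens (W := W) (p := p)) ∧
      exists_isNewformOf ∧
      (∀ (K : Type) [Field K] [NumberField K], poitouTate_selmerStructure_duality K) ∧
      (∀ (K : Type) [Field K] [NumberField K], poitouTate_sha_tateDual K) ∧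
      hsieh2014_exists_anticyclotomicPAdicLFunction ∧
      (∀ (N : ℕ) [NeZero N] (W : WeierstrassCurve ℚ) (K : Type) [Field K] [NumberField K],
        gross_zagier N W K) ∧
      (∀ (N : ℕ) [NeZero N] (W : WeierstrassCurve ℚ) (K : Type) [Field K] [NumberField K],
        kolyvagin N W K) ∧
      rank_eq_analyticRank_of_analyticRank_le_one ∧ HoffsteinLuo1997_exists_twist_L_one_ne_zero ∧
      mazur_not_dvd_maninConstant_of_odd ∧ bsdRHS_eq_of_isIsogenous) ∧
      thm210_thm211_bdpDisplay_pNew)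
    (h2 : (∀ (W : WeierstrassCurve ℚ) [W.IsElliptic] [W.IsGloballyMinimal] (p : ℕ) [Fact p.Prime],
        p = 3 → CellC W p → ¬ W.HasSplitMultiplicativeReductionAtPrime p → NonsplitBDPValueOnTreeInt W p) ∧
      (∀ (W : WeierstrassCurve ℚ) [W.IsElliptic] [W.IsGloballyMinimal] (p : ℕ) [Fact p.Prime],
        p = 3 → CellC W p → W.HasSplitMultiplicativeReductionAtPrime p → SplitBDPValueOnTreeInt W p))
    (hD : KellerYin2024.thmD_imcMult_exists_isBDPLFunction_isTorsion_charIdeal_eq_OPEN)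
    (hMCB : Summit.BirchSwinnertonDyer.BirchSwinnertonDyer.Theses.EisensteinPrimes.MazurMCOnCellB) :
    Summit.BirchSwinnertonDyer.BirchSwinnertonDyer.Theses.EisensteinPrimes.BSDpOnCellC :=
  bsdpOnCellC_of_stubs_reoriented hPub h2
    ⟨forall_nonsplitIMCEqOnTreeIntOther_of_thmD_OPEN hD, forall_splitIMCEqOnTreeIntOther_of_thmD_OPEN hD⟩
    hMCB

end Summit.BirchSwinnertonDyer.BirchSwinnertonDyer.Theorems.Reoriented

end
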